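import Literature.MathematicalPhysics.QuantumLattice.HubbardTTPrimeAffineBoxWordAdapters
import HarnessLib

/-!
# MULTILINEAR box words for the `t–t'` Hubbard energy density — the vertex rule for trilinear
# `(U, t', n)` words and the adapters multilinear ⇒ constant / affine, affine ⇒ multilinear

Family `hubbard` (topic `MathematicalPhysics/QuantumLattice`), companion of
`HubbardTTPrimeAffineBoxWords` / `HubbardTTPrimeAffineBoxWordAdapters` (the AFFINE words
`L₀ + L₁ U + L₂ t' + L₃ n ≤ e ≤ H₀ + …` on a cell `Set.Icc ![U₁,s₁,n₁] ![U₂,s₂,n₂]`, coordinates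
`θ 0 = U/t`, `θ 1 = t'/t`, `θ 2 = n`). The cell's second pointwise word shape is MULTILINEAR
(surrogate contract `_mlword_Icc`, produced by hubbard-box-eng-2 and hubbard-box-eng-4): eight coefficients on the
monomials `[1, θ0, θ1, θ2, θ0θ1, θ0θ2, θ1θ2, θ0θ1θ2]`,

  `M(θ) = c₀ + c₁ θ0 + c₂ θ1 + c₃ θ2 + c₄ θ0 θ1 + c₅ θ0 θ2 + c₆ θ1 θ2 + c₇ θ0 θ1 θ2`

(e.g. the `(t',U)`-bilinear interpolant of four corner `n`-sheets as a floor, a vacuum /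
particle–hole density chord of a `(t',U)`-plane as a cap). This file is the kernel bookkeeping that
turns such words into the constant windows the S1/S2 seam and the typed-box joins consume, and into
affine words, WITHOUT re-entering the physics:

* §1 THE VERTEX RULE (pure real analysis): a function affine in each of two / three variables
  separately which is `≥ 0` at the `4` / `8` vertices of a rectangle / box is `≥ 0` on it
  (`bilinear_nonneg_on_rect`, `trilinear_nonneg_on_Icc₃`) — multilinear functions on a box are
  vertex-polyhedral (Rikun 1997; McCormick's bilinear case, Neumaier 2004 §16); the proof is three
  nested segment steps (`affine_nonneg_on_Icc`).
* §2 ONE-SIDED ADAPTERS on a `(U, t', n)` cell: `mlFloor_Icc₃_weaken` / `mlCap_Icc₃_weaken` (a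
  multilinear floor/cap below/above another at the eight vertices is below/above it on the cell —
  the MERGE step for several pieces, with `forall_Icc₃_glue_U/_tPrime/_density`),
  `constFloor_of_mlFloor_Icc₃` / `constCap_of_mlCap_Icc₃` (eight vertex values ⇒ constant),
  `affineFloor_of_mlFloor_Icc₃` / `affineCap_of_mlCap_Icc₃` (eight vertex checks ⇒ affine),
  `mlFloor_of_affineFloor_Icc₃` / `mlCap_of_affineCap_Icc₃` (embedding, zero higher coefficients).
* §3 TWO-SIDED: `mlword_Icc₃_of_floor_of_cap`, `constWord_of_mlword_Icc₃` (the `EnergyWord F C`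
  shape), `affword_of_mlword_Icc₃` (the `_affword_Icc` shape), `mlword_of_affword_Icc₃`,
  `mlword_Icc₃_weaken`.
* §4 `U`-EXTENSIONS at zero loss (`energyDensityTT'_mono_U`): a multilinear floor whose `U`-slope
  `c₁ + c₄ θ1 + c₅ θ2 + c₇ θ1 θ2` is `≤ 0` at the four `(t', n)`-corners extends to every larger `U`
  (`mlFloor_Icc₃_extend_U_above`); a multilinear cap read at `U₁` caps the box below `U₁`
  (`mlCap_Icc₃_extend_U_below`).

Restriction to a sub-box is `forall_mem_Icc_vec3_mono` (any predicate); nothing here is restated.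
Everything is `linarith` / `linear_combination` over §1; no definition, no number, no physics beyond
the monotonicity of `e` in `U`. WHAT THIS IS NOT: a bound at any anchor; a cell rule; a phase word.

## References

* A. D. Rikun, *A convex envelope formula for multilinear functions*, J. Global Optim. 10 (1997)
  425–437 (multilinear functions over a box are vertex-polyhedral; extrema at vertices).
  [cite: Rikun1997MultilinearEnvelope, Thm 1.1]
* A. Neumaier, *Complete search in continuous global optimization and constraint satisfaction*,
  Acta Numerica 13 (2004), §16 (McCormick's bilinear relaxations from `(x − x̲)(y − y̲) ≥ 0`;
  envelopes of multilinear functions), §12 (sub-box bookkeeping).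
  [cite: Neumaier2004CompleteSearch, §16]
* R. T. Rockafellar, *Convex Analysis* (1970), Thm 32.2. [cite: Rockafellar1970, Thm 32.2]
* V. Bach, E. H. Lieb, J. P. Solovej, J. Stat. Phys. 76 (1994), eq. (2c.36) (monotonicity in `U`).
  [cite: BachLiebSolovej1994, eq. (2c.36)]
-/

noncomputable section

namespace Literature.MathematicalPhysics.QuantumLattice

namespace ThermodynamicLimit

open Set

/-! ### §1 The vertex rule for bilinear / trilinear forms -/

/-- **McCormick / vertex rule on a rectangle.** A function affine in each of two variables separately,
`α + β x + γ y + δ x y`, which is `≥ 0` at the four corners of `[x₁, x₂] × [y₁, y₂]` is `≥ 0` on the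
rectangle. [cite: Neumaier2004CompleteSearch, §16] -/
theorem bilinear_nonneg_on_rect {x₁ x₂ y₁ y₂ x y α β γ δ : ℝ} (hx₁ : x₁ ≤ x) (hx₂ : x ≤ x₂)
    (hy₁ : y₁ ≤ y) (hy₂ : y ≤ y₂)
    (c₁₁ : 0 ≤ α + β * x₁ + γ * y₁ + δ * x₁ * y₁) (c₁₂ : 0 ≤ α + β * x₁ + γ * y₂ + δ * x₁ * y₂)
    (c₂₁ : 0 ≤ α + β * x₂ + γ * y₁ + δ * x₂ * y₁) (c₂₂ : 0 ≤ α + β * x₂ + γ * y₂ + δ * x₂ * y₂) :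
    0 ≤ α + β * x + γ * y + δ * x * y := by
  have h₁ : 0 ≤ (α + β * x₁) + (γ + δ * x₁) * y :=
    affine_nonneg_on_Icc hy₁ hy₂ (by linear_combination c₁₁) (by linear_combination c₁₂)
  have h₂ : 0 ≤ (α + β * x₂) + (γ + δ * x₂) * y :=
    affine_nonneg_on_Icc hy₁ hy₂ (by linear_combination c₂₁) (by linear_combination c₂₂)
  have h : 0 ≤ (α + γ * y) + (β + δ * y) * x :=
    affine_nonneg_on_Icc hx₁ hx₂ (by linear_combination h₁) (by linear_combination h₂)
  linear_combination h

/-- **Vertex rule on a coordinate box** (trilinear forms are vertex-polyhedral): a function affine in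
each of three variables separately,
`c₀ + c₁ θ0 + c₂ θ1 + c₃ θ2 + c₄ θ0θ1 + c₅ θ0θ2 + c₆ θ1θ2 + c₇ θ0θ1θ2`, which is `≥ 0` at the eight
vertices of `Set.Icc ![a₀,a₁,a₂] ![b₀,b₁,b₂]` is `≥ 0` on the box (vertex `v_ijk` = `i`-th end in `θ0`,
`j`-th in `θ1`, `k`-th in `θ2`). [cite: Rikun1997MultilinearEnvelope, Thm 1.1] -/
theorem trilinear_nonneg_on_Icc₃ {a₀ a₁ a₂ b₀ b₁ b₂ c₀ c₁ c₂ c₃ c₄ c₅ c₆ c₇ : ℝ}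
    (v₁₁₁ : 0 ≤ c₀ + c₁ * a₀ + c₂ * a₁ + c₃ * a₂ + c₄ * a₀ * a₁ + c₅ * a₀ * a₂ + c₆ * a₁ * a₂ +
      c₇ * a₀ * a₁ * a₂)
    (v₁₁₂ : 0 ≤ c₀ + c₁ * a₀ + c₂ * a₁ + c₃ * b₂ + c₄ * a₀ * a₁ + c₅ * a₀ * b₂ + c₆ * a₁ * b₂ +
      c₇ * a₀ * a₁ * b₂)
    (v₁₂₁ : 0 ≤ c₀ + c₁ * a₀ + c₂ * b₁ + c₃ * a₂ + c₄ * a₀ * b₁ + c₅ * a₀ * a₂ + c₆ * b₁ * a₂ +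
      c₇ * a₀ * b₁ * a₂)
    (v₁₂₂ : 0 ≤ c₀ + c₁ * a₀ + c₂ * b₁ + c₃ * b₂ + c₄ * a₀ * b₁ + c₅ * a₀ * b₂ + c₆ * b₁ * b₂ +
      c₇ * a₀ * b₁ * b₂)
    (v₂₁₁ : 0 ≤ c₀ + c₁ * b₀ + c₂ * a₁ + c₃ * a₂ + c₄ * b₀ * a₁ + c₅ * b₀ * a₂ + c₆ * a₁ * a₂ +
      c₇ * b₀ * a₁ * a₂)
    (v₂₁₂ : 0 ≤ c₀ + c₁ * b₀ + c₂ * a₁ + c₃ * b₂ + c₄ * b₀ * a₁ + c₅ * b₀ * b₂ + c₆ * a₁ * b₂ +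
      c₇ * b₀ * a₁ * b₂)
    (v₂₂₁ : 0 ≤ c₀ + c₁ * b₀ + c₂ * b₁ + c₃ * a₂ + c₄ * b₀ * b₁ + c₅ * b₀ * a₂ + c₆ * b₁ * a₂ +
      c₇ * b₀ * b₁ * a₂)
    (v₂₂₂ : 0 ≤ c₀ + c₁ * b₀ + c₂ * b₁ + c₃ * b₂ + c₄ * b₀ * b₁ + c₅ * b₀ * b₂ + c₆ * b₁ * b₂ +
      c₇ * b₀ * b₁ * b₂) :
    ∀ θ ∈ Set.Icc (![a₀, a₁, a₂] : Fin 3 → ℝ) ![b₀, b₁, b₂],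
      0 ≤ c₀ + c₁ * θ 0 + c₂ * θ 1 + c₃ * θ 2 + c₄ * θ 0 * θ 1 + c₅ * θ 0 * θ 2 + c₆ * θ 1 * θ 2 +
        c₇ * θ 0 * θ 1 * θ 2 := by
  intro θ hθ
  obtain ⟨⟨k1, k2⟩, ⟨k3, k4⟩, ⟨k5, k6⟩⟩ := mem_Icc_vec3_iff.1 hθ
  -- the segment in `θ 2` at each of the four `(θ0, θ1)`-corners
  have e₁₁ : 0 ≤ (c₀ + c₁ * a₀ + c₂ * a₁ + c₄ * a₀ * a₁) + (c₃ + c₅ * a₀ + c₆ * a₁ + c₇ * a₀ * a₁) * θ 2 :=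
    affine_nonneg_on_Icc k5 k6 (by linear_combination v₁₁₁) (by linear_combination v₁₁₂)
  have e₁₂ : 0 ≤ (c₀ + c₁ * a₀ + c₂ * b₁ + c₄ * a₀ * b₁) + (c₃ + c₅ * a₀ + c₆ * b₁ + c₇ * a₀ * b₁) * θ 2 :=
    affine_nonneg_on_Icc k5 k6 (by linear_combination v₁₂₁) (by linear_combination v₁₂₂)
  have e₂₁ : 0 ≤ (c₀ + c₁ * b₀ + c₂ * a₁ + c₄ * b₀ * a₁) + (c₃ + c₅ * b₀ + c₆ * a₁ + c₇ * b₀ * a₁) * θ 2 :=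
    affine_nonneg_on_Icc k5 k6 (by linear_combination v₂₁₁) (by linear_combination v₂₁₂)
  have e₂₂ : 0 ≤ (c₀ + c₁ * b₀ + c₂ * b₁ + c₄ * b₀ * b₁) + (c₃ + c₅ * b₀ + c₆ * b₁ + c₇ * b₀ * b₁) * θ 2 :=
    affine_nonneg_on_Icc k5 k6 (by linear_combination v₂₂₁) (by linear_combination v₂₂₂)
  -- the rectangle in `(θ0, θ1)` with `θ 2` frozen
  have h := bilinear_nonneg_on_rect (α := c₀ + c₃ * θ 2) (β := c₁ + c₅ * θ 2) (γ := c₂ + c₆ * θ 2)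
    (δ := c₄ + c₇ * θ 2) k1 k2 k3 k4 (by linear_combination e₁₁) (by linear_combination e₁₂)
    (by linear_combination e₂₁) (by linear_combination e₂₂)
  linear_combination h

/-! ### §2 One-sided adapters on a `(U, t', n)` cell

Throughout, `θ 0 = U/t`, `θ 1 = t'/t`, `θ 2 = n`, the energy is `energyDensityTT' t (θ 1) (θ 0) (θ 2)`
and a multilinear form carries the coefficients `(c₀, …, c₇)` on
`[1, θ0, θ1, θ2, θ0θ1, θ0θ2, θ1θ2, θ0θ1θ2]`. -/

/-- **Weakening a multilinear floor** (the merge step for pieces): if `M' ≤ e` on a cell and the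
multilinear `M` is below `M'` at the eight vertices, then `M ≤ e` on the cell.
[cite: Rikun1997MultilinearEnvelope, Thm 1.1] -/
theorem mlFloor_Icc₃_weaken (t : ℝ) {a₀ a₁ a₂ b₀ b₁ b₂ c₀ c₁ c₂ c₃ c₄ c₅ c₆ c₇
    d₀ d₁ d₂ d₃ d₄ d₅ d₆ d₇ : ℝ}
    (h : ∀ θ ∈ Set.Icc (![a₀, a₁, a₂] : Fin 3 → ℝ) ![b₀, b₁, b₂],
      d₀ + d₁ * θ 0 + d₂ * θ 1 + d₃ * θ 2 + d₄ * θ 0 * θ 1 + d₅ * θ 0 * θ 2 + d₆ * θ 1 * θ 2 +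
        d₇ * θ 0 * θ 1 * θ 2 ≤ energyDensityTT' t (θ 1) (θ 0) (θ 2))
    (v₁₁₁ : c₀ + c₁ * a₀ + c₂ * a₁ + c₃ * a₂ + c₄ * a₀ * a₁ + c₅ * a₀ * a₂ + c₆ * a₁ * a₂ + c₇ * a₀ * a₁ * a₂ ≤
      d₀ + d₁ * a₀ + d₂ * a₁ + d₃ * a₂ + d₄ * a₀ * a₁ + d₅ * a₀ * a₂ + d₆ * a₁ * a₂ + d₇ * a₀ * a₁ * a₂)
    (v₁₁₂ : c₀ + c₁ * a₀ + c₂ * a₁ + c₃ * b₂ + c₄ * a₀ * a₁ + c₅ * a₀ * b₂ + c₆ * a₁ * b₂ + c₇ * a₀ * a₁ * b₂ ≤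
      d₀ + d₁ * a₀ + d₂ * a₁ + d₃ * b₂ + d₄ * a₀ * a₁ + d₅ * a₀ * b₂ + d₆ * a₁ * b₂ + d₇ * a₀ * a₁ * b₂)
    (v₁₂₁ : c₀ + c₁ * a₀ + c₂ * b₁ + c₃ * a₂ + c₄ * a₀ * b₁ + c₅ * a₀ * a₂ + c₆ * b₁ * a₂ + c₇ * a₀ * b₁ * a₂ ≤
      d₀ + d₁ * a₀ + d₂ * b₁ + d₃ * a₂ + d₄ * a₀ * b₁ + d₅ * a₀ * a₂ + d₆ * b₁ * a₂ + d₇ * a₀ * b₁ * a₂)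
    (v₁₂₂ : c₀ + c₁ * a₀ + c₂ * b₁ + c₃ * b₂ + c₄ * a₀ * b₁ + c₅ * a₀ * b₂ + c₆ * b₁ * b₂ + c₇ * a₀ * b₁ * b₂ ≤
      d₀ + d₁ * a₀ + d₂ * b₁ + d₃ * b₂ + d₄ * a₀ * b₁ + d₅ * a₀ * b₂ + d₆ * b₁ * b₂ + d₇ * a₀ * b₁ * b₂)
    (v₂₁₁ : c₀ + c₁ * b₀ + c₂ * a₁ + c₃ * a₂ + c₄ * b₀ * a₁ + c₅ * b₀ * a₂ + c₆ * a₁ * a₂ + c₇ * b₀ * a₁ * a₂ ≤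
      d₀ + d₁ * b₀ + d₂ * a₁ + d₃ * a₂ + d₄ * b₀ * a₁ + d₅ * b₀ * a₂ + d₆ * a₁ * a₂ + d₇ * b₀ * a₁ * a₂)
    (v₂₁₂ : c₀ + c₁ * b₀ + c₂ * a₁ + c₃ * b₂ + c₄ * b₀ * a₁ + c₅ * b₀ * b₂ + c₆ * a₁ * b₂ + c₇ * b₀ * a₁ * b₂ ≤
      d₀ + d₁ * b₀ + d₂ * a₁ + d₃ * b₂ + d₄ * b₀ * a₁ + d₅ * b₀ * b₂ + d₆ * a₁ * b₂ + d₇ * b₀ * a₁ * b₂)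
    (v₂₂₁ : c₀ + c₁ * b₀ + c₂ * b₁ + c₃ * a₂ + c₄ * b₀ * b₁ + c₅ * b₀ * a₂ + c₆ * b₁ * a₂ + c₇ * b₀ * b₁ * a₂ ≤
      d₀ + d₁ * b₀ + d₂ * b₁ + d₃ * a₂ + d₄ * b₀ * b₁ + d₅ * b₀ * a₂ + d₆ * b₁ * a₂ + d₇ * b₀ * b₁ * a₂)
    (v₂₂₂ : c₀ + c₁ * b₀ + c₂ * b₁ + c₃ * b₂ + c₄ * b₀ * b₁ + c₅ * b₀ * b₂ + c₆ * b₁ * b₂ + c₇ * b₀ * b₁ * b₂ ≤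
      d₀ + d₁ * b₀ + d₂ * b₁ + d₃ * b₂ + d₄ * b₀ * b₁ + d₅ * b₀ * b₂ + d₆ * b₁ * b₂ + d₇ * b₀ * b₁ * b₂) :
    ∀ θ ∈ Set.Icc (![a₀, a₁, a₂] : Fin 3 → ℝ) ![b₀, b₁, b₂],
      c₀ + c₁ * θ 0 + c₂ * θ 1 + c₃ * θ 2 + c₄ * θ 0 * θ 1 + c₅ * θ 0 * θ 2 + c₆ * θ 1 * θ 2 +
        c₇ * θ 0 * θ 1 * θ 2 ≤ energyDensityTT' t (θ 1) (θ 0) (θ 2) := by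
  intro θ hθ
  have hd := trilinear_nonneg_on_Icc₃ (a₀ := a₀) (a₁ := a₁) (a₂ := a₂) (b₀ := b₀) (b₁ := b₁) (b₂ := b₂)
    (c₀ := d₀ - c₀) (c₁ := d₁ - c₁) (c₂ := d₂ - c₂) (c₃ := d₃ - c₃) (c₄ := d₄ - c₄) (c₅ := d₅ - c₅)
    (c₆ := d₆ - c₆) (c₇ := d₇ - c₇) (by linear_combination v₁₁₁) (by linear_combination v₁₁₂)
    (by linear_combination v₁₂₁) (by linear_combination v₁₂₂) (by linear_combination v₂₁₁)
    (by linear_combination v₂₁₂) (by linear_combination v₂₂₁) (by linear_combination v₂₂₂) θ hθ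
  linear_combination h θ hθ + hd

/-- **Weakening a multilinear cap**: if `e ≤ M'` on a cell and the multilinear `M` is above `M'` at the
eight vertices, then `e ≤ M` on the cell. [cite: Rikun1997MultilinearEnvelope, Thm 1.1] -/
theorem mlCap_Icc₃_weaken (t : ℝ) {a₀ a₁ a₂ b₀ b₁ b₂ c₀ c₁ c₂ c₃ c₄ c₅ c₆ c₇
    d₀ d₁ d₂ d₃ d₄ d₅ d₆ d₇ : ℝ}
    (h : ∀ θ ∈ Set.Icc (![a₀, a₁, a₂] : Fin 3 → ℝ) ![b₀, b₁, b₂],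
      energyDensityTT' t (θ 1) (θ 0) (θ 2) ≤ d₀ + d₁ * θ 0 + d₂ * θ 1 + d₃ * θ 2 + d₄ * θ 0 * θ 1 +
        d₅ * θ 0 * θ 2 + d₆ * θ 1 * θ 2 + d₇ * θ 0 * θ 1 * θ 2)
    (v₁₁₁ : d₀ + d₁ * a₀ + d₂ * a₁ + d₃ * a₂ + d₄ * a₀ * a₁ + d₅ * a₀ * a₂ + d₆ * a₁ * a₂ + d₇ * a₀ * a₁ * a₂ ≤
      c₀ + c₁ * a₀ + c₂ * a₁ + c₃ * a₂ + c₄ * a₀ * a₁ + c₅ * a₀ * a₂ + c₆ * a₁ * a₂ + c₇ * a₀ * a₁ * a₂)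
    (v₁₁₂ : d₀ + d₁ * a₀ + d₂ * a₁ + d₃ * b₂ + d₄ * a₀ * a₁ + d₅ * a₀ * b₂ + d₆ * a₁ * b₂ + d₇ * a₀ * a₁ * b₂ ≤
      c₀ + c₁ * a₀ + c₂ * a₁ + c₃ * b₂ + c₄ * a₀ * a₁ + c₅ * a₀ * b₂ + c₆ * a₁ * b₂ + c₇ * a₀ * a₁ * b₂)
    (v₁₂₁ : d₀ + d₁ * a₀ + d₂ * b₁ + d₃ * a₂ + d₄ * a₀ * b₁ + d₅ * a₀ * a₂ + d₆ * b₁ * a₂ + d₇ * a₀ * b₁ * a₂ ≤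
      c₀ + c₁ * a₀ + c₂ * b₁ + c₃ * a₂ + c₄ * a₀ * b₁ + c₅ * a₀ * a₂ + c₆ * b₁ * a₂ + c₇ * a₀ * b₁ * a₂)
    (v₁₂₂ : d₀ + d₁ * a₀ + d₂ * b₁ + d₃ * b₂ + d₄ * a₀ * b₁ + d₅ * a₀ * b₂ + d₆ * b₁ * b₂ + d₇ * a₀ * b₁ * b₂ ≤
      c₀ + c₁ * a₀ + c₂ * b₁ + c₃ * b₂ + c₄ * a₀ * b₁ + c₅ * a₀ * b₂ + c₆ * b₁ * b₂ + c₇ * a₀ * b₁ * b₂)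
    (v₂₁₁ : d₀ + d₁ * b₀ + d₂ * a₁ + d₃ * a₂ + d₄ * b₀ * a₁ + d₅ * b₀ * a₂ + d₆ * a₁ * a₂ + d₇ * b₀ * a₁ * a₂ ≤
      c₀ + c₁ * b₀ + c₂ * a₁ + c₃ * a₂ + c₄ * b₀ * a₁ + c₅ * b₀ * a₂ + c₆ * a₁ * a₂ + c₇ * b₀ * a₁ * a₂)
    (v₂₁₂ : d₀ + d₁ * b₀ + d₂ * a₁ + d₃ * b₂ + d₄ * b₀ * a₁ + d₅ * b₀ * b₂ + d₆ * a₁ * b₂ + d₇ * b₀ * a₁ * b₂ ≤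
      c₀ + c₁ * b₀ + c₂ * a₁ + c₃ * b₂ + c₄ * b₀ * a₁ + c₅ * b₀ * b₂ + c₆ * a₁ * b₂ + c₇ * b₀ * a₁ * b₂)
    (v₂₂₁ : d₀ + d₁ * b₀ + d₂ * b₁ + d₃ * a₂ + d₄ * b₀ * b₁ + d₅ * b₀ * a₂ + d₆ * b₁ * a₂ + d₇ * b₀ * b₁ * a₂ ≤
      c₀ + c₁ * b₀ + c₂ * b₁ + c₃ * a₂ + c₄ * b₀ * b₁ + c₅ * b₀ * a₂ + c₆ * b₁ * a₂ + c₇ * b₀ * b₁ * a₂)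
    (v₂₂₂ : d₀ + d₁ * b₀ + d₂ * b₁ + d₃ * b₂ + d₄ * b₀ * b₁ + d₅ * b₀ * b₂ + d₆ * b₁ * b₂ + d₇ * b₀ * b₁ * b₂ ≤
      c₀ + c₁ * b₀ + c₂ * b₁ + c₃ * b₂ + c₄ * b₀ * b₁ + c₅ * b₀ * b₂ + c₆ * b₁ * b₂ + c₇ * b₀ * b₁ * b₂) :
    ∀ θ ∈ Set.Icc (![a₀, a₁, a₂] : Fin 3 → ℝ) ![b₀, b₁, b₂],
      energyDensityTT' t (θ 1) (θ 0) (θ 2) ≤ c₀ + c₁ * θ 0 + c₂ * θ 1 + c₃ * θ 2 + c₄ * θ 0 * θ 1 +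
        c₅ * θ 0 * θ 2 + c₆ * θ 1 * θ 2 + c₇ * θ 0 * θ 1 * θ 2 := by
  intro θ hθ
  have hd := trilinear_nonneg_on_Icc₃ (a₀ := a₀) (a₁ := a₁) (a₂ := a₂) (b₀ := b₀) (b₁ := b₁) (b₂ := b₂)
    (c₀ := c₀ - d₀) (c₁ := c₁ - d₁) (c₂ := c₂ - d₂) (c₃ := c₃ - d₃) (c₄ := c₄ - d₄) (c₅ := c₅ - d₅)
    (c₆ := c₆ - d₆) (c₇ := c₇ - d₇) (by linear_combination v₁₁₁) (by linear_combination v₁₁₂)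
    (by linear_combination v₁₂₁) (by linear_combination v₁₂₂) (by linear_combination v₂₁₁)
    (by linear_combination v₂₁₂) (by linear_combination v₂₂₁) (by linear_combination v₂₂₂) θ hθ
  linear_combination h θ hθ + hd

/-- **Multilinear floor ⇒ constant floor**: a multilinear floor on a cell whose eight vertex values are
`≥ F` gives `F ≤ e` on the cell (the vertex envelope). [cite: Rikun1997MultilinearEnvelope, Thm 1.1] -/
theorem constFloor_of_mlFloor_Icc₃ (t : ℝ) {a₀ a₁ a₂ b₀ b₁ b₂ d₀ d₁ d₂ d₃ d₄ d₅ d₆ d₇ F : ℝ}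
    (h : ∀ θ ∈ Set.Icc (![a₀, a₁, a₂] : Fin 3 → ℝ) ![b₀, b₁, b₂],
      d₀ + d₁ * θ 0 + d₂ * θ 1 + d₃ * θ 2 + d₄ * θ 0 * θ 1 + d₅ * θ 0 * θ 2 + d₆ * θ 1 * θ 2 +
        d₇ * θ 0 * θ 1 * θ 2 ≤ energyDensityTT' t (θ 1) (θ 0) (θ 2))
    (v₁₁₁ : F ≤ d₀ + d₁ * a₀ + d₂ * a₁ + d₃ * a₂ + d₄ * a₀ * a₁ + d₅ * a₀ * a₂ + d₆ * a₁ * a₂ + d₇ * a₀ * a₁ * a₂)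
    (v₁₁₂ : F ≤ d₀ + d₁ * a₀ + d₂ * a₁ + d₃ * b₂ + d₄ * a₀ * a₁ + d₅ * a₀ * b₂ + d₆ * a₁ * b₂ + d₇ * a₀ * a₁ * b₂)
    (v₁₂₁ : F ≤ d₀ + d₁ * a₀ + d₂ * b₁ + d₃ * a₂ + d₄ * a₀ * b₁ + d₅ * a₀ * a₂ + d₆ * b₁ * a₂ + d₇ * a₀ * b₁ * a₂)
    (v₁₂₂ : F ≤ d₀ + d₁ * a₀ + d₂ * b₁ + d₃ * b₂ + d₄ * a₀ * b₁ + d₅ * a₀ * b₂ + d₆ * b₁ * b₂ + d₇ * a₀ * b₁ * b₂)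
    (v₂₁₁ : F ≤ d₀ + d₁ * b₀ + d₂ * a₁ + d₃ * a₂ + d₄ * b₀ * a₁ + d₅ * b₀ * a₂ + d₆ * a₁ * a₂ + d₇ * b₀ * a₁ * a₂)
    (v₂₁₂ : F ≤ d₀ + d₁ * b₀ + d₂ * a₁ + d₃ * b₂ + d₄ * b₀ * a₁ + d₅ * b₀ * b₂ + d₆ * a₁ * b₂ + d₇ * b₀ * a₁ * b₂)
    (v₂₂₁ : F ≤ d₀ + d₁ * b₀ + d₂ * b₁ + d₃ * a₂ + d₄ * b₀ * b₁ + d₅ * b₀ * a₂ + d₆ * b₁ * a₂ + d₇ * b₀ * b₁ * a₂)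
    (v₂₂₂ : F ≤ d₀ + d₁ * b₀ + d₂ * b₁ + d₃ * b₂ + d₄ * b₀ * b₁ + d₅ * b₀ * b₂ + d₆ * b₁ * b₂ + d₇ * b₀ * b₁ * b₂) :
    ∀ θ ∈ Set.Icc (![a₀, a₁, a₂] : Fin 3 → ℝ) ![b₀, b₁, b₂],
      F ≤ energyDensityTT' t (θ 1) (θ 0) (θ 2) := by
  intro θ hθ
  have hw := mlFloor_Icc₃_weaken t (c₀ := F) (c₁ := 0) (c₂ := 0) (c₃ := 0) (c₄ := 0) (c₅ := 0)
    (c₆ := 0) (c₇ := 0) h (by linear_combination v₁₁₁) (by linear_combination v₁₁₂)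
    (by linear_combination v₁₂₁) (by linear_combination v₁₂₂) (by linear_combination v₂₁₁)
    (by linear_combination v₂₁₂) (by linear_combination v₂₂₁) (by linear_combination v₂₂₂) θ hθ
  linear_combination hw

/-- **Multilinear cap ⇒ constant cap**: a multilinear cap on a cell whose eight vertex values are
`≤ C` gives `e ≤ C` on the cell. [cite: Rikun1997MultilinearEnvelope, Thm 1.1] -/
theorem constCap_of_mlCap_Icc₃ (t : ℝ) {a₀ a₁ a₂ b₀ b₁ b₂ d₀ d₁ d₂ d₃ d₄ d₅ d₆ d₇ C : ℝ}
    (h : ∀ θ ∈ Set.Icc (![a₀, a₁, a₂] : Fin 3 → ℝ) ![b₀, b₁, b₂],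
      energyDensityTT' t (θ 1) (θ 0) (θ 2) ≤ d₀ + d₁ * θ 0 + d₂ * θ 1 + d₃ * θ 2 + d₄ * θ 0 * θ 1 +
        d₅ * θ 0 * θ 2 + d₆ * θ 1 * θ 2 + d₇ * θ 0 * θ 1 * θ 2)
    (v₁₁₁ : d₀ + d₁ * a₀ + d₂ * a₁ + d₃ * a₂ + d₄ * a₀ * a₁ + d₅ * a₀ * a₂ + d₆ * a₁ * a₂ + d₇ * a₀ * a₁ * a₂ ≤ C)
    (v₁₁₂ : d₀ + d₁ * a₀ + d₂ * a₁ + d₃ * b₂ + d₄ * a₀ * a₁ + d₅ * a₀ * b₂ + d₆ * a₁ * b₂ + d₇ * a₀ * a₁ * b₂ ≤ C)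
    (v₁₂₁ : d₀ + d₁ * a₀ + d₂ * b₁ + d₃ * a₂ + d₄ * a₀ * b₁ + d₅ * a₀ * a₂ + d₆ * b₁ * a₂ + d₇ * a₀ * b₁ * a₂ ≤ C)
    (v₁₂₂ : d₀ + d₁ * a₀ + d₂ * b₁ + d₃ * b₂ + d₄ * a₀ * b₁ + d₅ * a₀ * b₂ + d₆ * b₁ * b₂ + d₇ * a₀ * b₁ * b₂ ≤ C)
    (v₂₁₁ : d₀ + d₁ * b₀ + d₂ * a₁ + d₃ * a₂ + d₄ * b₀ * a₁ + d₅ * b₀ * a₂ + d₆ * a₁ * a₂ + d₇ * b₀ * a₁ * a₂ ≤ C)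
    (v₂₁₂ : d₀ + d₁ * b₀ + d₂ * a₁ + d₃ * b₂ + d₄ * b₀ * a₁ + d₅ * b₀ * b₂ + d₆ * a₁ * b₂ + d₇ * b₀ * a₁ * b₂ ≤ C)
    (v₂₂₁ : d₀ + d₁ * b₀ + d₂ * b₁ + d₃ * a₂ + d₄ * b₀ * b₁ + d₅ * b₀ * a₂ + d₆ * b₁ * a₂ + d₇ * b₀ * b₁ * a₂ ≤ C)
    (v₂₂₂ : d₀ + d₁ * b₀ + d₂ * b₁ + d₃ * b₂ + d₄ * b₀ * b₁ + d₅ * b₀ * b₂ + d₆ * b₁ * b₂ + d₇ * b₀ * b₁ * b₂ ≤ C) :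
    ∀ θ ∈ Set.Icc (![a₀, a₁, a₂] : Fin 3 → ℝ) ![b₀, b₁, b₂],
      energyDensityTT' t (θ 1) (θ 0) (θ 2) ≤ C := by
  intro θ hθ
  have hw := mlCap_Icc₃_weaken t (c₀ := C) (c₁ := 0) (c₂ := 0) (c₃ := 0) (c₄ := 0) (c₅ := 0)
    (c₆ := 0) (c₇ := 0) h (by linear_combination v₁₁₁) (by linear_combination v₁₁₂)
    (by linear_combination v₁₂₁) (by linear_combination v₁₂₂) (by linear_combination v₂₁₁)
    (by linear_combination v₂₁₂) (by linear_combination v₂₂₁) (by linear_combination v₂₂₂) θ hθ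
  linear_combination hw

/-- **Multilinear floor ⇒ affine floor**: a multilinear floor on a cell and an affine `L` below it at
the eight vertices give the affine floor `L ≤ e` on the cell (shape of
`energyDensityTT'_affineFloor_Icc₃_of_cornerRows`). [cite: Rikun1997MultilinearEnvelope, Thm 1.1] -/
theorem affineFloor_of_mlFloor_Icc₃ (t : ℝ) {a₀ a₁ a₂ b₀ b₁ b₂ d₀ d₁ d₂ d₃ d₄ d₅ d₆ d₇
    L₀ L₁ L₂ L₃ : ℝ}
    (h : ∀ θ ∈ Set.Icc (![a₀, a₁, a₂] : Fin 3 → ℝ) ![b₀, b₁, b₂],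
      d₀ + d₁ * θ 0 + d₂ * θ 1 + d₃ * θ 2 + d₄ * θ 0 * θ 1 + d₅ * θ 0 * θ 2 + d₆ * θ 1 * θ 2 +
        d₇ * θ 0 * θ 1 * θ 2 ≤ energyDensityTT' t (θ 1) (θ 0) (θ 2))
    (v₁₁₁ : L₀ + L₁ * a₀ + L₂ * a₁ + L₃ * a₂ ≤
      d₀ + d₁ * a₀ + d₂ * a₁ + d₃ * a₂ + d₄ * a₀ * a₁ + d₅ * a₀ * a₂ + d₆ * a₁ * a₂ + d₇ * a₀ * a₁ * a₂)
    (v₁₁₂ : L₀ + L₁ * a₀ + L₂ * a₁ + L₃ * b₂ ≤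
      d₀ + d₁ * a₀ + d₂ * a₁ + d₃ * b₂ + d₄ * a₀ * a₁ + d₅ * a₀ * b₂ + d₆ * a₁ * b₂ + d₇ * a₀ * a₁ * b₂)
    (v₁₂₁ : L₀ + L₁ * a₀ + L₂ * b₁ + L₃ * a₂ ≤
      d₀ + d₁ * a₀ + d₂ * b₁ + d₃ * a₂ + d₄ * a₀ * b₁ + d₅ * a₀ * a₂ + d₆ * b₁ * a₂ + d₇ * a₀ * b₁ * a₂)
    (v₁₂₂ : L₀ + L₁ * a₀ + L₂ * b₁ + L₃ * b₂ ≤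
      d₀ + d₁ * a₀ + d₂ * b₁ + d₃ * b₂ + d₄ * a₀ * b₁ + d₅ * a₀ * b₂ + d₆ * b₁ * b₂ + d₇ * a₀ * b₁ * b₂)
    (v₂₁₁ : L₀ + L₁ * b₀ + L₂ * a₁ + L₃ * a₂ ≤
      d₀ + d₁ * b₀ + d₂ * a₁ + d₃ * a₂ + d₄ * b₀ * a₁ + d₅ * b₀ * a₂ + d₆ * a₁ * a₂ + d₇ * b₀ * a₁ * a₂)
    (v₂₁₂ : L₀ + L₁ * b₀ + L₂ * a₁ + L₃ * b₂ ≤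
      d₀ + d₁ * b₀ + d₂ * a₁ + d₃ * b₂ + d₄ * b₀ * a₁ + d₅ * b₀ * b₂ + d₆ * a₁ * b₂ + d₇ * b₀ * a₁ * b₂)
    (v₂₂₁ : L₀ + L₁ * b₀ + L₂ * b₁ + L₃ * a₂ ≤
      d₀ + d₁ * b₀ + d₂ * b₁ + d₃ * a₂ + d₄ * b₀ * b₁ + d₅ * b₀ * a₂ + d₆ * b₁ * a₂ + d₇ * b₀ * b₁ * a₂)
    (v₂₂₂ : L₀ + L₁ * b₀ + L₂ * b₁ + L₃ * b₂ ≤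
      d₀ + d₁ * b₀ + d₂ * b₁ + d₃ * b₂ + d₄ * b₀ * b₁ + d₅ * b₀ * b₂ + d₆ * b₁ * b₂ + d₇ * b₀ * b₁ * b₂) :
    ∀ θ ∈ Set.Icc (![a₀, a₁, a₂] : Fin 3 → ℝ) ![b₀, b₁, b₂],
      L₀ + L₁ * θ 0 + L₂ * θ 1 + L₃ * θ 2 ≤ energyDensityTT' t (θ 1) (θ 0) (θ 2) := by
  intro θ hθ
  have hw := mlFloor_Icc₃_weaken t (c₀ := L₀) (c₁ := L₁) (c₂ := L₂) (c₃ := L₃) (c₄ := 0) (c₅ := 0)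
    (c₆ := 0) (c₇ := 0) h (by linear_combination v₁₁₁) (by linear_combination v₁₁₂)
    (by linear_combination v₁₂₁) (by linear_combination v₁₂₂) (by linear_combination v₂₁₁)
    (by linear_combination v₂₁₂) (by linear_combination v₂₂₁) (by linear_combination v₂₂₂) θ hθ
  linear_combination hw

/-- **Multilinear cap ⇒ affine cap**: a multilinear cap on a cell and an affine `H` above it at the
eight vertices give the affine cap `e ≤ H` on the cell. [cite: Rikun1997MultilinearEnvelope, Thm 1.1] -/
theorem affineCap_of_mlCap_Icc₃ (t : ℝ) {a₀ a₁ a₂ b₀ b₁ b₂ d₀ d₁ d₂ d₃ d₄ d₅ d₆ d₇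
    H₀ H₁ H₂ H₃ : ℝ}
    (h : ∀ θ ∈ Set.Icc (![a₀, a₁, a₂] : Fin 3 → ℝ) ![b₀, b₁, b₂],
      energyDensityTT' t (θ 1) (θ 0) (θ 2) ≤ d₀ + d₁ * θ 0 + d₂ * θ 1 + d₃ * θ 2 + d₄ * θ 0 * θ 1 +
        d₅ * θ 0 * θ 2 + d₆ * θ 1 * θ 2 + d₇ * θ 0 * θ 1 * θ 2)
    (v₁₁₁ : d₀ + d₁ * a₀ + d₂ * a₁ + d₃ * a₂ + d₄ * a₀ * a₁ + d₅ * a₀ * a₂ + d₆ * a₁ * a₂ + d₇ * a₀ * a₁ * a₂ ≤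
      H₀ + H₁ * a₀ + H₂ * a₁ + H₃ * a₂)
    (v₁₁₂ : d₀ + d₁ * a₀ + d₂ * a₁ + d₃ * b₂ + d₄ * a₀ * a₁ + d₅ * a₀ * b₂ + d₆ * a₁ * b₂ + d₇ * a₀ * a₁ * b₂ ≤
      H₀ + H₁ * a₀ + H₂ * a₁ + H₃ * b₂)
    (v₁₂₁ : d₀ + d₁ * a₀ + d₂ * b₁ + d₃ * a₂ + d₄ * a₀ * b₁ + d₅ * a₀ * a₂ + d₆ * b₁ * a₂ + d₇ * a₀ * b₁ * a₂ ≤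
      H₀ + H₁ * a₀ + H₂ * b₁ + H₃ * a₂)
    (v₁₂₂ : d₀ + d₁ * a₀ + d₂ * b₁ + d₃ * b₂ + d₄ * a₀ * b₁ + d₅ * a₀ * b₂ + d₆ * b₁ * b₂ + d₇ * a₀ * b₁ * b₂ ≤
      H₀ + H₁ * a₀ + H₂ * b₁ + H₃ * b₂)
    (v₂₁₁ : d₀ + d₁ * b₀ + d₂ * a₁ + d₃ * a₂ + d₄ * b₀ * a₁ + d₅ * b₀ * a₂ + d₆ * a₁ * a₂ + d₇ * b₀ * a₁ * a₂ ≤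
      H₀ + H₁ * b₀ + H₂ * a₁ + H₃ * a₂)
    (v₂₁₂ : d₀ + d₁ * b₀ + d₂ * a₁ + d₃ * b₂ + d₄ * b₀ * a₁ + d₅ * b₀ * b₂ + d₆ * a₁ * b₂ + d₇ * b₀ * a₁ * b₂ ≤
      H₀ + H₁ * b₀ + H₂ * a₁ + H₃ * b₂)
    (v₂₂₁ : d₀ + d₁ * b₀ + d₂ * b₁ + d₃ * a₂ + d₄ * b₀ * b₁ + d₅ * b₀ * a₂ + d₆ * b₁ * a₂ + d₇ * b₀ * b₁ * a₂ ≤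
      H₀ + H₁ * b₀ + H₂ * b₁ + H₃ * a₂)
    (v₂₂₂ : d₀ + d₁ * b₀ + d₂ * b₁ + d₃ * b₂ + d₄ * b₀ * b₁ + d₅ * b₀ * b₂ + d₆ * b₁ * b₂ + d₇ * b₀ * b₁ * b₂ ≤
      H₀ + H₁ * b₀ + H₂ * b₁ + H₃ * b₂) :
    ∀ θ ∈ Set.Icc (![a₀, a₁, a₂] : Fin 3 → ℝ) ![b₀, b₁, b₂],
      energyDensityTT' t (θ 1) (θ 0) (θ 2) ≤ H₀ + H₁ * θ 0 + H₂ * θ 1 + H₃ * θ 2 := by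
  intro θ hθ
  have hw := mlCap_Icc₃_weaken t (c₀ := H₀) (c₁ := H₁) (c₂ := H₂) (c₃ := H₃) (c₄ := 0) (c₅ := 0)
    (c₆ := 0) (c₇ := 0) h (by linear_combination v₁₁₁) (by linear_combination v₁₁₂)
    (by linear_combination v₁₂₁) (by linear_combination v₁₂₂) (by linear_combination v₂₁₁)
    (by linear_combination v₂₁₂) (by linear_combination v₂₂₁) (by linear_combination v₂₂₂) θ hθ
  linear_combination hw

/-- **Affine floor as a multilinear floor** (zero coefficients on the mixed monomials), so affine and
multilinear pieces can be merged by `mlFloor_Icc₃_weaken`. [cite: Neumaier2004CompleteSearch, §16] -/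
theorem mlFloor_of_affineFloor_Icc₃ (t : ℝ) {lo hi : Fin 3 → ℝ} {L₀ L₁ L₂ L₃ : ℝ}
    (h : ∀ θ ∈ Set.Icc lo hi, L₀ + L₁ * θ 0 + L₂ * θ 1 + L₃ * θ 2 ≤ energyDensityTT' t (θ 1) (θ 0) (θ 2)) :
    ∀ θ ∈ Set.Icc lo hi,
      L₀ + L₁ * θ 0 + L₂ * θ 1 + L₃ * θ 2 + 0 * θ 0 * θ 1 + 0 * θ 0 * θ 2 + 0 * θ 1 * θ 2 +
        0 * θ 0 * θ 1 * θ 2 ≤ energyDensityTT' t (θ 1) (θ 0) (θ 2) := by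
  intro θ hθ
  linear_combination h θ hθ

/-- **Affine cap as a multilinear cap** (zero coefficients on the mixed monomials).
[cite: Neumaier2004CompleteSearch, §16] -/
theorem mlCap_of_affineCap_Icc₃ (t : ℝ) {lo hi : Fin 3 → ℝ} {H₀ H₁ H₂ H₃ : ℝ}
    (h : ∀ θ ∈ Set.Icc lo hi, energyDensityTT' t (θ 1) (θ 0) (θ 2) ≤ H₀ + H₁ * θ 0 + H₂ * θ 1 + H₃ * θ 2) :
    ∀ θ ∈ Set.Icc lo hi,
      energyDensityTT' t (θ 1) (θ 0) (θ 2) ≤ H₀ + H₁ * θ 0 + H₂ * θ 1 + H₃ * θ 2 + 0 * θ 0 * θ 1 +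
        0 * θ 0 * θ 2 + 0 * θ 1 * θ 2 + 0 * θ 0 * θ 1 * θ 2 := by
  intro θ hθ
  linear_combination h θ hθ

/-! ### §3 Two-sided words -/

/-- **The two-sided MULTILINEAR WORD** from a multilinear floor and a multilinear cap on the same box —
literally the `_mlword_Icc` shape (8 + 8 coefficients, literal first, every monomial present).
[cite: Neumaier2004CompleteSearch, §16] -/
theorem mlword_Icc₃_of_floor_of_cap (t : ℝ) {lo hi : Fin 3 → ℝ}
    {c₀ c₁ c₂ c₃ c₄ c₅ c₆ c₇ d₀ d₁ d₂ d₃ d₄ d₅ d₆ d₇ : ℝ}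
    (hL : ∀ θ ∈ Set.Icc lo hi,
      c₀ + c₁ * θ 0 + c₂ * θ 1 + c₃ * θ 2 + c₄ * θ 0 * θ 1 + c₅ * θ 0 * θ 2 + c₆ * θ 1 * θ 2 +
        c₇ * θ 0 * θ 1 * θ 2 ≤ energyDensityTT' t (θ 1) (θ 0) (θ 2))
    (hH : ∀ θ ∈ Set.Icc lo hi,
      energyDensityTT' t (θ 1) (θ 0) (θ 2) ≤ d₀ + d₁ * θ 0 + d₂ * θ 1 + d₃ * θ 2 + d₄ * θ 0 * θ 1 +
        d₅ * θ 0 * θ 2 + d₆ * θ 1 * θ 2 + d₇ * θ 0 * θ 1 * θ 2) :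
    ∀ θ ∈ Set.Icc lo hi,
      c₀ + c₁ * θ 0 + c₂ * θ 1 + c₃ * θ 2 + c₄ * θ 0 * θ 1 + c₅ * θ 0 * θ 2 + c₆ * θ 1 * θ 2 +
          c₇ * θ 0 * θ 1 * θ 2 ≤ energyDensityTT' t (θ 1) (θ 0) (θ 2) ∧
        energyDensityTT' t (θ 1) (θ 0) (θ 2) ≤ d₀ + d₁ * θ 0 + d₂ * θ 1 + d₃ * θ 2 + d₄ * θ 0 * θ 1 +
          d₅ * θ 0 * θ 2 + d₆ * θ 1 * θ 2 + d₇ * θ 0 * θ 1 * θ 2 :=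
  fun θ hθ => ⟨hL θ hθ, hH θ hθ⟩

/-- **Multilinear word ⇒ constant word** (vertex envelope): a multilinear two-sided word on
`Set.Icc ![U₁,s₁,n₁] ![U₂,s₂,n₂]` with `F` below the eight vertex values of the floor and `C` above
the eight vertex values of the cap gives the constant window `F ≤ e ≤ C` on the box — the shape of
the S1/S2 seam (`HoldsOn (EnergyWord F C)`) and of the constant-cover meter. The sixteen checks are
`norm_num` on literal tables. [cite: Rikun1997MultilinearEnvelope, Thm 1.1] -/
theorem constWord_of_mlword_Icc₃ (t : ℝ) {a₀ a₁ a₂ b₀ b₁ b₂ c₀ c₁ c₂ c₃ c₄ c₅ c₆ c₇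
    d₀ d₁ d₂ d₃ d₄ d₅ d₆ d₇ F C : ℝ}
    (h : ∀ θ ∈ Set.Icc (![a₀, a₁, a₂] : Fin 3 → ℝ) ![b₀, b₁, b₂],
      c₀ + c₁ * θ 0 + c₂ * θ 1 + c₃ * θ 2 + c₄ * θ 0 * θ 1 + c₅ * θ 0 * θ 2 + c₆ * θ 1 * θ 2 +
          c₇ * θ 0 * θ 1 * θ 2 ≤ energyDensityTT' t (θ 1) (θ 0) (θ 2) ∧
        energyDensityTT' t (θ 1) (θ 0) (θ 2) ≤ d₀ + d₁ * θ 0 + d₂ * θ 1 + d₃ * θ 2 + d₄ * θ 0 * θ 1 +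
          d₅ * θ 0 * θ 2 + d₆ * θ 1 * θ 2 + d₇ * θ 0 * θ 1 * θ 2)
    (f₁₁₁ : F ≤ c₀ + c₁ * a₀ + c₂ * a₁ + c₃ * a₂ + c₄ * a₀ * a₁ + c₅ * a₀ * a₂ + c₆ * a₁ * a₂ + c₇ * a₀ * a₁ * a₂)
    (f₁₁₂ : F ≤ c₀ + c₁ * a₀ + c₂ * a₁ + c₃ * b₂ + c₄ * a₀ * a₁ + c₅ * a₀ * b₂ + c₆ * a₁ * b₂ + c₇ * a₀ * a₁ * b₂)
    (f₁₂₁ : F ≤ c₀ + c₁ * a₀ + c₂ * b₁ + c₃ * a₂ + c₄ * a₀ * b₁ + c₅ * a₀ * a₂ + c₆ * b₁ * a₂ + c₇ * a₀ * b₁ * a₂)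
    (f₁₂₂ : F ≤ c₀ + c₁ * a₀ + c₂ * b₁ + c₃ * b₂ + c₄ * a₀ * b₁ + c₅ * a₀ * b₂ + c₆ * b₁ * b₂ + c₇ * a₀ * b₁ * b₂)
    (f₂₁₁ : F ≤ c₀ + c₁ * b₀ + c₂ * a₁ + c₃ * a₂ + c₄ * b₀ * a₁ + c₅ * b₀ * a₂ + c₆ * a₁ * a₂ + c₇ * b₀ * a₁ * a₂)
    (f₂₁₂ : F ≤ c₀ + c₁ * b₀ + c₂ * a₁ + c₃ * b₂ + c₄ * b₀ * a₁ + c₅ * b₀ * b₂ + c₆ * a₁ * b₂ + c₇ * b₀ * a₁ * b₂)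
    (f₂₂₁ : F ≤ c₀ + c₁ * b₀ + c₂ * b₁ + c₃ * a₂ + c₄ * b₀ * b₁ + c₅ * b₀ * a₂ + c₆ * b₁ * a₂ + c₇ * b₀ * b₁ * a₂)
    (f₂₂₂ : F ≤ c₀ + c₁ * b₀ + c₂ * b₁ + c₃ * b₂ + c₄ * b₀ * b₁ + c₅ * b₀ * b₂ + c₆ * b₁ * b₂ + c₇ * b₀ * b₁ * b₂)
    (g₁₁₁ : d₀ + d₁ * a₀ + d₂ * a₁ + d₃ * a₂ + d₄ * a₀ * a₁ + d₅ * a₀ * a₂ + d₆ * a₁ * a₂ + d₇ * a₀ * a₁ * a₂ ≤ C)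
    (g₁₁₂ : d₀ + d₁ * a₀ + d₂ * a₁ + d₃ * b₂ + d₄ * a₀ * a₁ + d₅ * a₀ * b₂ + d₆ * a₁ * b₂ + d₇ * a₀ * a₁ * b₂ ≤ C)
    (g₁₂₁ : d₀ + d₁ * a₀ + d₂ * b₁ + d₃ * a₂ + d₄ * a₀ * b₁ + d₅ * a₀ * a₂ + d₆ * b₁ * a₂ + d₇ * a₀ * b₁ * a₂ ≤ C)
    (g₁₂₂ : d₀ + d₁ * a₀ + d₂ * b₁ + d₃ * b₂ + d₄ * a₀ * b₁ + d₅ * a₀ * b₂ + d₆ * b₁ * b₂ + d₇ * a₀ * b₁ * b₂ ≤ C)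
    (g₂₁₁ : d₀ + d₁ * b₀ + d₂ * a₁ + d₃ * a₂ + d₄ * b₀ * a₁ + d₅ * b₀ * a₂ + d₆ * a₁ * a₂ + d₇ * b₀ * a₁ * a₂ ≤ C)
    (g₂₁₂ : d₀ + d₁ * b₀ + d₂ * a₁ + d₃ * b₂ + d₄ * b₀ * a₁ + d₅ * b₀ * b₂ + d₆ * a₁ * b₂ + d₇ * b₀ * a₁ * b₂ ≤ C)
    (g₂₂₁ : d₀ + d₁ * b₀ + d₂ * b₁ + d₃ * a₂ + d₄ * b₀ * b₁ + d₅ * b₀ * a₂ + d₆ * b₁ * a₂ + d₇ * b₀ * b₁ * a₂ ≤ C)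
    (g₂₂₂ : d₀ + d₁ * b₀ + d₂ * b₁ + d₃ * b₂ + d₄ * b₀ * b₁ + d₅ * b₀ * b₂ + d₆ * b₁ * b₂ + d₇ * b₀ * b₁ * b₂ ≤ C) :
    ∀ θ ∈ Set.Icc (![a₀, a₁, a₂] : Fin 3 → ℝ) ![b₀, b₁, b₂],
      F ≤ energyDensityTT' t (θ 1) (θ 0) (θ 2) ∧ energyDensityTT' t (θ 1) (θ 0) (θ 2) ≤ C :=
  fun θ hθ =>
    ⟨constFloor_of_mlFloor_Icc₃ t (fun θ' hθ' => (h θ' hθ').1) f₁₁₁ f₁₁₂ f₁₂₁ f₁₂₂ f₂₁₁ f₂₁₂ f₂₂₁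
        f₂₂₂ θ hθ,
      constCap_of_mlCap_Icc₃ t (fun θ' hθ' => (h θ' hθ').2) g₁₁₁ g₁₁₂ g₁₂₁ g₁₂₂ g₂₁₁ g₂₁₂ g₂₂₁
        g₂₂₂ θ hθ⟩

/-- **Multilinear word ⇒ affine word**: a multilinear two-sided word on a box with an affine `L` below
the floor and an affine `H` above the cap at the eight vertices gives the affine word
`L ≤ e ≤ H` on the box (the `_affword_Icc` shape). [cite: Rikun1997MultilinearEnvelope, Thm 1.1] -/
theorem affword_of_mlword_Icc₃ (t : ℝ) {a₀ a₁ a₂ b₀ b₁ b₂ c₀ c₁ c₂ c₃ c₄ c₅ c₆ c₇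
    d₀ d₁ d₂ d₃ d₄ d₅ d₆ d₇ L₀ L₁ L₂ L₃ H₀ H₁ H₂ H₃ : ℝ}
    (h : ∀ θ ∈ Set.Icc (![a₀, a₁, a₂] : Fin 3 → ℝ) ![b₀, b₁, b₂],
      c₀ + c₁ * θ 0 + c₂ * θ 1 + c₃ * θ 2 + c₄ * θ 0 * θ 1 + c₅ * θ 0 * θ 2 + c₆ * θ 1 * θ 2 +
          c₇ * θ 0 * θ 1 * θ 2 ≤ energyDensityTT' t (θ 1) (θ 0) (θ 2) ∧
        energyDensityTT' t (θ 1) (θ 0) (θ 2) ≤ d₀ + d₁ * θ 0 + d₂ * θ 1 + d₃ * θ 2 + d₄ * θ 0 * θ 1 +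
          d₅ * θ 0 * θ 2 + d₆ * θ 1 * θ 2 + d₇ * θ 0 * θ 1 * θ 2)
    (f₁₁₁ : L₀ + L₁ * a₀ + L₂ * a₁ + L₃ * a₂ ≤
      c₀ + c₁ * a₀ + c₂ * a₁ + c₃ * a₂ + c₄ * a₀ * a₁ + c₅ * a₀ * a₂ + c₆ * a₁ * a₂ + c₇ * a₀ * a₁ * a₂)
    (f₁₁₂ : L₀ + L₁ * a₀ + L₂ * a₁ + L₃ * b₂ ≤
      c₀ + c₁ * a₀ + c₂ * a₁ + c₃ * b₂ + c₄ * a₀ * a₁ + c₅ * a₀ * b₂ + c₆ * a₁ * b₂ + c₇ * a₀ * a₁ * b₂)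
    (f₁₂₁ : L₀ + L₁ * a₀ + L₂ * b₁ + L₃ * a₂ ≤
      c₀ + c₁ * a₀ + c₂ * b₁ + c₃ * a₂ + c₄ * a₀ * b₁ + c₅ * a₀ * a₂ + c₆ * b₁ * a₂ + c₇ * a₀ * b₁ * a₂)
    (f₁₂₂ : L₀ + L₁ * a₀ + L₂ * b₁ + L₃ * b₂ ≤
      c₀ + c₁ * a₀ + c₂ * b₁ + c₃ * b₂ + c₄ * a₀ * b₁ + c₅ * a₀ * b₂ + c₆ * b₁ * b₂ + c₇ * a₀ * b₁ * b₂)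
    (f₂₁₁ : L₀ + L₁ * b₀ + L₂ * a₁ + L₃ * a₂ ≤
      c₀ + c₁ * b₀ + c₂ * a₁ + c₃ * a₂ + c₄ * b₀ * a₁ + c₅ * b₀ * a₂ + c₆ * a₁ * a₂ + c₇ * b₀ * a₁ * a₂)
    (f₂₁₂ : L₀ + L₁ * b₀ + L₂ * a₁ + L₃ * b₂ ≤
      c₀ + c₁ * b₀ + c₂ * a₁ + c₃ * b₂ + c₄ * b₀ * a₁ + c₅ * b₀ * b₂ + c₆ * a₁ * b₂ + c₇ * b₀ * a₁ * b₂)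
    (f₂₂₁ : L₀ + L₁ * b₀ + L₂ * b₁ + L₃ * a₂ ≤
      c₀ + c₁ * b₀ + c₂ * b₁ + c₃ * a₂ + c₄ * b₀ * b₁ + c₅ * b₀ * a₂ + c₆ * b₁ * a₂ + c₇ * b₀ * b₁ * a₂)
    (f₂₂₂ : L₀ + L₁ * b₀ + L₂ * b₁ + L₃ * b₂ ≤
      c₀ + c₁ * b₀ + c₂ * b₁ + c₃ * b₂ + c₄ * b₀ * b₁ + c₅ * b₀ * b₂ + c₆ * b₁ * b₂ + c₇ * b₀ * b₁ * b₂)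
    (g₁₁₁ : d₀ + d₁ * a₀ + d₂ * a₁ + d₃ * a₂ + d₄ * a₀ * a₁ + d₅ * a₀ * a₂ + d₆ * a₁ * a₂ + d₇ * a₀ * a₁ * a₂ ≤
      H₀ + H₁ * a₀ + H₂ * a₁ + H₃ * a₂)
    (g₁₁₂ : d₀ + d₁ * a₀ + d₂ * a₁ + d₃ * b₂ + d₄ * a₀ * a₁ + d₅ * a₀ * b₂ + d₆ * a₁ * b₂ + d₇ * a₀ * a₁ * b₂ ≤
      H₀ + H₁ * a₀ + H₂ * a₁ + H₃ * b₂)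
    (g₁₂₁ : d₀ + d₁ * a₀ + d₂ * b₁ + d₃ * a₂ + d₄ * a₀ * b₁ + d₅ * a₀ * a₂ + d₆ * b₁ * a₂ + d₇ * a₀ * b₁ * a₂ ≤
      H₀ + H₁ * a₀ + H₂ * b₁ + H₃ * a₂)
    (g₁₂₂ : d₀ + d₁ * a₀ + d₂ * b₁ + d₃ * b₂ + d₄ * a₀ * b₁ + d₅ * a₀ * b₂ + d₆ * b₁ * b₂ + d₇ * a₀ * b₁ * b₂ ≤
      H₀ + H₁ * a₀ + H₂ * b₁ + H₃ * b₂)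
    (g₂₁₁ : d₀ + d₁ * b₀ + d₂ * a₁ + d₃ * a₂ + d₄ * b₀ * a₁ + d₅ * b₀ * a₂ + d₆ * a₁ * a₂ + d₇ * b₀ * a₁ * a₂ ≤
      H₀ + H₁ * b₀ + H₂ * a₁ + H₃ * a₂)
    (g₂₁₂ : d₀ + d₁ * b₀ + d₂ * a₁ + d₃ * b₂ + d₄ * b₀ * a₁ + d₅ * b₀ * b₂ + d₆ * a₁ * b₂ + d₇ * b₀ * a₁ * b₂ ≤
      H₀ + H₁ * b₀ + H₂ * a₁ + H₃ * b₂)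
    (g₂₂₁ : d₀ + d₁ * b₀ + d₂ * b₁ + d₃ * a₂ + d₄ * b₀ * b₁ + d₅ * b₀ * a₂ + d₆ * b₁ * a₂ + d₇ * b₀ * b₁ * a₂ ≤
      H₀ + H₁ * b₀ + H₂ * b₁ + H₃ * a₂)
    (g₂₂₂ : d₀ + d₁ * b₀ + d₂ * b₁ + d₃ * b₂ + d₄ * b₀ * b₁ + d₅ * b₀ * b₂ + d₆ * b₁ * b₂ + d₇ * b₀ * b₁ * b₂ ≤
      H₀ + H₁ * b₀ + H₂ * b₁ + H₃ * b₂) :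
    ∀ θ ∈ Set.Icc (![a₀, a₁, a₂] : Fin 3 → ℝ) ![b₀, b₁, b₂],
      L₀ + L₁ * θ 0 + L₂ * θ 1 + L₃ * θ 2 ≤ energyDensityTT' t (θ 1) (θ 0) (θ 2) ∧
        energyDensityTT' t (θ 1) (θ 0) (θ 2) ≤ H₀ + H₁ * θ 0 + H₂ * θ 1 + H₃ * θ 2 :=
  fun θ hθ =>
    ⟨affineFloor_of_mlFloor_Icc₃ t (fun θ' hθ' => (h θ' hθ').1) f₁₁₁ f₁₁₂ f₁₂₁ f₁₂₂ f₂₁₁ f₂₁₂ f₂₂₁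
        f₂₂₂ θ hθ,
      affineCap_of_mlCap_Icc₃ t (fun θ' hθ' => (h θ' hθ').2) g₁₁₁ g₁₁₂ g₁₂₁ g₁₂₂ g₂₁₁ g₂₁₂ g₂₂₁
        g₂₂₂ θ hθ⟩

/-- **Affine word ⇒ multilinear word** (embedding with zero mixed coefficients; the converse direction
of `affword_of_mlword_Icc₃`, for producers that serve one shape only). [cite: Neumaier2004CompleteSearch, §16] -/
theorem mlword_of_affword_Icc₃ (t : ℝ) {lo hi : Fin 3 → ℝ} {L₀ L₁ L₂ L₃ H₀ H₁ H₂ H₃ : ℝ}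
    (h : ∀ θ ∈ Set.Icc lo hi,
      L₀ + L₁ * θ 0 + L₂ * θ 1 + L₃ * θ 2 ≤ energyDensityTT' t (θ 1) (θ 0) (θ 2) ∧
        energyDensityTT' t (θ 1) (θ 0) (θ 2) ≤ H₀ + H₁ * θ 0 + H₂ * θ 1 + H₃ * θ 2) :
    ∀ θ ∈ Set.Icc lo hi,
      L₀ + L₁ * θ 0 + L₂ * θ 1 + L₃ * θ 2 + 0 * θ 0 * θ 1 + 0 * θ 0 * θ 2 + 0 * θ 1 * θ 2 +
          0 * θ 0 * θ 1 * θ 2 ≤ energyDensityTT' t (θ 1) (θ 0) (θ 2) ∧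
        energyDensityTT' t (θ 1) (θ 0) (θ 2) ≤ H₀ + H₁ * θ 0 + H₂ * θ 1 + H₃ * θ 2 + 0 * θ 0 * θ 1 +
          0 * θ 0 * θ 2 + 0 * θ 1 * θ 2 + 0 * θ 0 * θ 1 * θ 2 :=
  fun θ hθ =>
    ⟨mlFloor_of_affineFloor_Icc₃ t (fun θ' hθ' => (h θ' hθ').1) θ hθ,
      mlCap_of_affineCap_Icc₃ t (fun θ' hθ' => (h θ' hθ').2) θ hθ⟩

/-! ### §4 `U`-extensions of multilinear words at zero loss (monotonicity of `e` in `U`) -/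

/-- **Open-above-`U` extension of a multilinear floor at zero loss.** A multilinear floor `M ≤ e` on
`[U₁, U₂] × [s₁, s₂] × [n₁, n₂]` (`0 ≤ U₁ ≤ U₂`, `0 ≤ n₁`, `n₂ < 2`) whose `U`-slope
`c₁ + c₄ θ1 + c₅ θ2 + c₇ θ1 θ2` is `≤ 0` at the four `(t', n)`-corners of the cell is a floor on
`[U₁, U₃] × [s₁, s₂] × [n₁, n₂]` for every `U₃`: above `U₂` the energy does not decrease
(`energyDensityTT'_mono_U`) while `M` does not increase (its `U`-slope is bilinear in `(θ1, θ2)`,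
hence `≤ 0` on the rectangle by the vertex rule). [cite: BachLiebSolovej1994, eq. (2c.36)] -/
theorem mlFloor_Icc₃_extend_U_above (t : ℝ) {U₁ U₂ U₃ s₁ s₂ n₁ n₂ c₀ c₁ c₂ c₃ c₄ c₅ c₆ c₇ : ℝ}
    (hU₁ : 0 ≤ U₁) (hU : U₁ ≤ U₂) (hn0 : 0 ≤ n₁) (hn2 : n₂ < 2)
    (d₁₁ : c₁ + c₄ * s₁ + c₅ * n₁ + c₇ * s₁ * n₁ ≤ 0) (d₁₂ : c₁ + c₄ * s₁ + c₅ * n₂ + c₇ * s₁ * n₂ ≤ 0)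
    (d₂₁ : c₁ + c₄ * s₂ + c₅ * n₁ + c₇ * s₂ * n₁ ≤ 0) (d₂₂ : c₁ + c₄ * s₂ + c₅ * n₂ + c₇ * s₂ * n₂ ≤ 0)
    (h : ∀ θ ∈ Set.Icc (![U₁, s₁, n₁] : Fin 3 → ℝ) ![U₂, s₂, n₂],
      c₀ + c₁ * θ 0 + c₂ * θ 1 + c₃ * θ 2 + c₄ * θ 0 * θ 1 + c₅ * θ 0 * θ 2 + c₆ * θ 1 * θ 2 +
        c₇ * θ 0 * θ 1 * θ 2 ≤ energyDensityTT' t (θ 1) (θ 0) (θ 2)) :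
    ∀ θ ∈ Set.Icc (![U₁, s₁, n₁] : Fin 3 → ℝ) ![U₃, s₂, n₂],
      c₀ + c₁ * θ 0 + c₂ * θ 1 + c₃ * θ 2 + c₄ * θ 0 * θ 1 + c₅ * θ 0 * θ 2 + c₆ * θ 1 * θ 2 +
        c₇ * θ 0 * θ 1 * θ 2 ≤ energyDensityTT' t (θ 1) (θ 0) (θ 2) := by
  intro θ hθ
  obtain ⟨⟨k1, _⟩, ⟨k3, k4⟩, ⟨k5, k6⟩⟩ := mem_Icc_vec3_iff.1 hθ
  rcases le_total (θ 0) U₂ with hu | hu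
  · exact h θ (mem_Icc_vec3_iff.2 ⟨⟨k1, hu⟩, ⟨k3, k4⟩, ⟨k5, k6⟩⟩)
  · have h₂ := h ![U₂, θ 1, θ 2] (mem_Icc_vec3_iff.2 ⟨⟨hU, le_rfl⟩, ⟨k3, k4⟩, ⟨k5, k6⟩⟩)
    simp only [Matrix.cons_val_zero, Matrix.cons_val_one, Matrix.cons_val] at h₂
    have hm := energyDensityTT'_mono_U t (θ 1) (hn0.trans k5) (lt_of_le_of_lt k6 hn2)
      (hU₁.trans hU) hu
    -- the `U`-slope of `M` is `≤ 0` on the `(t', n)`-rectangle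
    have hslope : 0 ≤ -c₁ + (-c₄) * θ 1 + (-c₅) * θ 2 + (-c₇) * θ 1 * θ 2 :=
      bilinear_nonneg_on_rect k3 k4 k5 k6 (by linear_combination d₁₁) (by linear_combination d₁₂)
        (by linear_combination d₂₁) (by linear_combination d₂₂)
    have hdec : (c₁ + c₄ * θ 1 + c₅ * θ 2 + c₇ * θ 1 * θ 2) * θ 0 ≤
        (c₁ + c₄ * θ 1 + c₅ * θ 2 + c₇ * θ 1 * θ 2) * U₂ :=
      mul_le_mul_of_nonpos_left hu (by linear_combination hslope)
    linear_combination h₂ + hm + hdec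

/-- **Below-`U` extension of a multilinear cap, read at `U₁`.** A multilinear cap on
`[U₁, U₂] × [s₁, s₂] × [n₁, n₂]` (`0 ≤ U₀`, `U₁ ≤ U₂`, `0 ≤ n₁`, `n₂ < 2`) caps the box below,
`[U₀, U₁] × [s₁, s₂] × [n₁, n₂]`, by its value AT `U₁` — a cap bilinear in `(t', n)`, written in
the eight-coefficient shape with zero `U`-coefficients (`e` is nondecreasing in `U`).
[cite: BachLiebSolovej1994, eq. (2c.36)] -/
theorem mlCap_Icc₃_extend_U_below (t : ℝ) {U₀ U₁ U₂ s₁ s₂ n₁ n₂ d₀ d₁ d₂ d₃ d₄ d₅ d₆ d₇ : ℝ}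
    (hU₀ : 0 ≤ U₀) (hU : U₁ ≤ U₂) (hn0 : 0 ≤ n₁) (hn2 : n₂ < 2)
    (h : ∀ θ ∈ Set.Icc (![U₁, s₁, n₁] : Fin 3 → ℝ) ![U₂, s₂, n₂],
      energyDensityTT' t (θ 1) (θ 0) (θ 2) ≤ d₀ + d₁ * θ 0 + d₂ * θ 1 + d₃ * θ 2 + d₄ * θ 0 * θ 1 +
        d₅ * θ 0 * θ 2 + d₆ * θ 1 * θ 2 + d₇ * θ 0 * θ 1 * θ 2) :
    ∀ θ ∈ Set.Icc (![U₀, s₁, n₁] : Fin 3 → ℝ) ![U₁, s₂, n₂],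
      energyDensityTT' t (θ 1) (θ 0) (θ 2) ≤ (d₀ + d₁ * U₁) + 0 * θ 0 + (d₂ + d₄ * U₁) * θ 1 +
        (d₃ + d₅ * U₁) * θ 2 + 0 * θ 0 * θ 1 + 0 * θ 0 * θ 2 + (d₆ + d₇ * U₁) * θ 1 * θ 2 +
        0 * θ 0 * θ 1 * θ 2 := by
  intro θ hθ
  obtain ⟨⟨k1, k2⟩, ⟨k3, k4⟩, ⟨k5, k6⟩⟩ := mem_Icc_vec3_iff.1 hθ
  have h₁ := h ![U₁, θ 1, θ 2] (mem_Icc_vec3_iff.2 ⟨⟨le_rfl, hU⟩, ⟨k3, k4⟩, ⟨k5, k6⟩⟩)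
  simp only [Matrix.cons_val_zero, Matrix.cons_val_one, Matrix.cons_val] at h₁
  have hm := energyDensityTT'_mono_U t (θ 1) (hn0.trans k5) (lt_of_le_of_lt k6 hn2)
    (hU₀.trans k1) k2
  linear_combination h₁ + hm

end ThermodynamicLimit

end Literature.MathematicalPhysics.QuantumLattice
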